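/-
Copyright (c) 2026. All rights reserved.
Released under Apache 2.0 license as described in the file LICENSE.
Authors: abc-iut cell, wave-5 seat abc-iut-w5-d188 (row HATZPOW-PI; successor residue of
abc-iut-w6-d074's row THM26II-SIGMA-STAR).
-/
import Mathlib.Topology.Algebra.Category.ProfiniteGrp.Completion
import Mathlib.GroupTheory.NoncommPiCoprod
import Literature.AnabelianGeometry.AbsoluteAnabelian.AbsTopIThm26iiSigmaStar
import Literature.AnabelianGeometry.AbsoluteAnabelian.ZHatCompletionFreeProcyclic
import HarnessLib

/-!
# Profinite completion commutes with finite products; `Ẑ^m ≅ ∏_l ℤ_l^m`; (∗) is (∗)_Σ at `Σ ⊇ Primes`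

S. Mochizuki, *The Absolute Anabelian Geometry of Hyperbolic Curves* (2004) [AbsAnab], Lemma 1.1.4 (ii)
p. 7, condition (∗): "the maximal torsion-free quotient `(Δ″)^{ab} ↠ Q″` […] on which `G″` acts
trivially is a finitely generated free `Ẑ`-module" — typed by abc-iut-L4-t4 as
`FundamentalExtension.StarCondition` with target `HatZPow m`, Mathlib's profinite completion of `ℤ^m`;
and S. Mochizuki, *Topics in Absolute Anabelian Geometry I* (2012) [AbsTopI], Thm 2.6 (ii), proof
p. 23 ("`Q_l := Q ⊗ ℤ_l` […] the `ℤ_l`-ranks of `R_l`, `Q_l` are independent of `l ∈ Σ`") — typed by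
abc-iut-w6-d074 as `FundamentalExtension.SigmaStarCondition S` with target the MODEL
`HatZSigmaPow S m = ∏_{l ∈ Σ} ℤ_l^m`.

PROOF-ONLY file (no definition, no instance, no notation; nothing landed is edited or restated).  It
settles the comparison left open in `AbsTopIThm26iiSigmaStar.lean` ("Deliberately NOT here: the
comparison `StarCondition ↔ SigmaStarCondition Primes` (needs `Ẑ^m ≅ ∏_l ℤ_l^m` for Mathlib's
profinite completion of `ℤ^m` […]) — TODO(general form)"):

* `ProfiniteCompletionPi.exists_continuousMulEquiv_completion_pi` — **Mathlib's profinite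
  completion commutes with finite products**: for a finite family of groups `G i`, there is an
  isomorphism of topological groups `completion (∏ i, G i) ≃ₜ* ∏ i, completion (G i)` carrying
  `η(g)` to `(η(g i))_i` (forward: the componentwise lifts; backward: the product of the lifts of the
  coordinate embeddings, whose images commute by density; the two composites are the identity by
  density of `η`).  Classical [cite: RibesZalesskii2010, §3.2 / Thm 2.7.1];
* `nonempty_hatZPow_continuousMulEquiv_pi` — `Ẑ^m ≃ₜ* (Fin m → Ẑ)`;
  `nonempty_hatZPow_continuousMulEquiv_hatZSigmaPow` — **`Ẑ^m ≃ₜ* Ẑ_Σ^m = ∏_{l ∈ Σ} ℤ_l^m`** for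
  every `Σ` containing all primes (rank-one bridge: the tree's
  `ZHatCompletion.exists_continuousMulEquiv_padicProd`, `Ẑ ≃ₜ* ∏_p ℤ_p`);
* `FundamentalExtension.starCondition_iff_sigmaStarCondition` — for `Σ ⊇ Primes`,
  **`E.StarCondition ↔ E.SigmaStarCondition Σ`**: abc-iut-w6-d074's any-`Σ` closer
  `thm26ii_of_sigmaStarCondition` SPECIALISES to the printed input (∗) of [AbsAnab] Lemma 1.1.4 (ii)
  (FACT-LIST F-0012) at `Σ = Primes`; `starCondition_iff_sigmaStarCondition_primes` /
  `…_univ` are the two named instances.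

HONEST FRAMING: classical profinite group theory; [AbsAnab]/[AbsTopI] are refereed, undisputed
papers; (∗)/(∗)_Σ remain typed INPUTS, never asserted; nothing here bears on [IUTchIII] Cor. 3.12 or
takes a side; typed ≠ proved elsewhere.
-/

noncomputable section

open CategoryTheory ProfiniteGrp ProfiniteGrp.ProfiniteCompletion Topology

namespace Literature.AnabelianGeometry.AbsoluteAnabelian

universe u

/-! ### Profinite completion of a finite product -/

namespace ProfiniteCompletionPi

/-- **Pointwise universal property of the profinite completion**: the lift of `f : G → P` agrees with
`f` on `η(G)`. [cite: RibesZalesskii2010, §3.2] -/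
theorem lift_etaFn {G : GrpCat.{u}} {P : ProfiniteGrp.{u}} (f : G ⟶ GrpCat.of P) (x : G) :
    (lift f).hom (etaFn G x) = f.hom x :=
  ConcreteCategory.congr_hom (lift_eta f) x

/-- In a topological monoid, a finite `noncommProd` of continuous functions is continuous.
[folklore] -/
private theorem continuous_noncommProd {ι : Type*} {X M : Type*} [TopologicalSpace X] [Monoid M]
    [TopologicalSpace M] [ContinuousMul M] (f : ι → X → M) (hf : ∀ i, Continuous (f i))
    (s : Finset ι) (comm : ∀ x : X, (s : Set ι).Pairwise fun a b => Commute (f a x) (f b x)) :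
    Continuous fun x => s.noncommProd (fun i => f i x) (comm x) := by
  classical
  induction s using Finset.induction_on with
  | empty =>
    simp only [Finset.noncommProd_empty]
    exact continuous_const
  | insert a s ha ih =>
    have hs : ∀ x : X, (s : Set ι).Pairwise fun a b => Commute (f a x) (f b x) := fun x =>
      (comm x).mono (Finset.coe_subset.2 (Finset.subset_insert a s))
    have h : (fun x => (insert a s).noncommProd (fun i => f i x) (comm x)) =
        fun x => f a x * s.noncommProd (fun i => f i x) (hs x) := by
      funext x
      exact Finset.noncommProd_insert_of_notMem _ _ _ _ ha
    rw [h]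
    exact (hf a).mul (ih hs)

variable {ι : Type u} [Fintype ι] (G : ι → Type u) [∀ i, Group (G i)]

/-- **Profinite completion commutes with finite products.**  For a finite family of (discrete) groups
`G i`, Mathlib's profinite completion of `∏ i, G i` is isomorphic, as a topological group, to the
product of the profinite completions, by an isomorphism carrying `η(g)` to `(η(g i))_i`.  (Forward:
the componentwise lifts of `∏ G ↠ G i → completion (G i)`; backward: the product of the lifts of the
coordinate embeddings `G i ↪ ∏ G → completion (∏ G)`, whose images commute pairwise because they do
so on the dense subgroups `η(G i)`; both composites are the identity on the dense images of `η`,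
hence everywhere.) [cite: RibesZalesskii2010, §3.2] -/
theorem exists_continuousMulEquiv_completion_pi :
    ∃ e : completion (GrpCat.of (∀ i, G i)) ≃ₜ* (∀ i, completion (GrpCat.of (G i))),
      ∀ g : ∀ i, G i,
        e (etaFn (GrpCat.of (∀ i, G i)) g) = fun i => etaFn (GrpCat.of (G i)) (g i) := by
  classical
  -- the objects
  let Gpi : GrpCat.{u} := GrpCat.of (∀ i, G i)
  let C : ι → ProfiniteGrp.{u} := fun i => completion (GrpCat.of (G i))
  -- forward components: lifts of `∏ G ↠ G i → completion (G i)`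
  let φ : ∀ i, (Gpi ⟶ GrpCat.of (C i)) := fun i =>
    GrpCat.ofHom ((eta (GrpCat.of (G i))).hom.comp (Pi.evalMonoidHom G i))
  let F : ∀ i, (completion Gpi ⟶ C i) := fun i => lift (φ i)
  have hF : ∀ (i) (g : ∀ i, G i), (F i).hom (etaFn Gpi g) = etaFn (GrpCat.of (G i)) (g i) :=
    fun i g => lift_etaFn (φ i) g
  let Ff : completion Gpi →ₜ* (∀ i, C i) :=
    { toFun := fun x i => (F i).hom x
      map_one' := funext fun i => map_one (F i).hom
      map_mul' := fun x y => funext fun i => map_mul (F i).hom x y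
      continuous_toFun := continuous_pi fun i => (F i).hom.continuous }
  have hFf : ∀ g : ∀ i, G i, Ff (etaFn Gpi g) = fun i => etaFn (GrpCat.of (G i)) (g i) :=
    fun g => funext fun i => hF i g
  -- backward components: lifts of the coordinate embeddings `G i ↪ ∏ G → completion (∏ G)`
  let ψ : ∀ i, (GrpCat.of (G i) ⟶ GrpCat.of (completion Gpi)) := fun i =>
    GrpCat.ofHom ((eta Gpi).hom.comp (MonoidHom.mulSingle G i))
  let B : ∀ i, (C i ⟶ completion Gpi) := fun i => lift (ψ i)
  have hB : ∀ (i) (a : G i), (B i).hom (etaFn (GrpCat.of (G i)) a) = etaFn Gpi (Pi.mulSingle i a) :=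
    fun i a => lift_etaFn (ψ i) a
  -- their images commute pairwise (closed condition, true on the dense images of `η`)
  have hcomm : Pairwise fun i j => ∀ (x : C i) (y : C j),
      Commute ((B i).hom.toMonoidHom x) ((B j).hom.toMonoidHom y) := by
    intro i j hij x y
    have hd : DenseRange (Prod.map (etaFn (GrpCat.of (G i))) (etaFn (GrpCat.of (G j)))) :=
      (denseRange (GrpCat.of (G i))).prodMap (denseRange (GrpCat.of (G j)))
    have hc : IsClosed {q : C i × C j |
        (B i).hom q.1 * (B j).hom q.2 = (B j).hom q.2 * (B i).hom q.1} :=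
      isClosed_eq
        (((B i).hom.continuous.comp continuous_fst).mul ((B j).hom.continuous.comp continuous_snd))
        (((B j).hom.continuous.comp continuous_snd).mul ((B i).hom.continuous.comp continuous_fst))
    have key : ∀ q : C i × C j,
        (B i).hom q.1 * (B j).hom q.2 = (B j).hom q.2 * (B i).hom q.1 := by
      intro q
      refine hd.induction_on q hc ?_
      rintro ⟨a, b⟩
      change (B i).hom (etaFn (GrpCat.of (G i)) a) * (B j).hom (etaFn (GrpCat.of (G j)) b) =
        (B j).hom (etaFn (GrpCat.of (G j)) b) * (B i).hom (etaFn (GrpCat.of (G i)) a)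
      rw [hB, hB]
      have h := (Pi.mulSingle_commute hij a b).eq
      change (eta Gpi).hom (Pi.mulSingle i a) * (eta Gpi).hom (Pi.mulSingle j b) =
        (eta Gpi).hom (Pi.mulSingle j b) * (eta Gpi).hom (Pi.mulSingle i a)
      rw [← map_mul, ← map_mul, h]
    exact key (x, y)
  let Bm : (∀ i, C i) →* completion Gpi :=
    MonoidHom.noncommPiCoprod (fun i => (B i).hom.toMonoidHom) hcomm
  have hBm_cont : Continuous Bm :=
    continuous_noncommProd (fun i (y : ∀ i, C i) => (B i).hom.toMonoidHom (y i))
      (fun i => (B i).hom.continuous.comp (continuous_apply i)) Finset.univ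
      (fun _ => fun _ _ _ _ h => hcomm h _ _)
  let Bc : (∀ i, C i) →ₜ* completion Gpi := { Bm with continuous_toFun := hBm_cont }
  -- `B (η(g i))_i = η(g)`
  have hBeta : ∀ g : ∀ i, G i, Bc (fun i => etaFn (GrpCat.of (G i)) (g i)) = etaFn Gpi g := by
    intro g
    change Finset.univ.noncommProd (fun i => (B i).hom.toMonoidHom (etaFn (GrpCat.of (G i)) (g i)))
      (fun _ _ _ _ h => hcomm h _ _) = etaFn Gpi g
    have h1 : Finset.univ.noncommProd
        (fun i => (B i).hom.toMonoidHom (etaFn (GrpCat.of (G i)) (g i)))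
        (fun _ _ _ _ h => hcomm h _ _) =
        Finset.univ.noncommProd (fun i => (eta Gpi).hom (Pi.mulSingle i (g i)))
        (fun _ _ _ _ h => ((Pi.mulSingle_commute h _ _).map (eta Gpi).hom)) :=
      Finset.noncommProd_congr rfl (fun i _ => hB i (g i)) _
    rw [h1, ← Finset.map_noncommProd _ _ (fun _ _ _ _ h => Pi.mulSingle_commute h _ _),
      Finset.noncommProd_mulSingle g]
    rfl
  -- the two composites are the identity
  have h1 : ∀ x, Bc (Ff x) = x := by
    have h := (denseRange Gpi).equalizer (Bc.continuous.comp Ff.continuous) continuous_id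
      (funext fun g => by
        change Bc (Ff (etaFn Gpi g)) = etaFn Gpi g
        rw [hFf, hBeta])
    exact fun x => congrFun h x
  have h2 : ∀ y, Ff (Bc y) = y := by
    have hd : DenseRange (fun (g : ∀ i, G i) (i : ι) => etaFn (GrpCat.of (G i)) (g i)) :=
      DenseRange.piMap fun i => denseRange (GrpCat.of (G i))
    have h := hd.equalizer (Ff.continuous.comp Bc.continuous) continuous_id
      (funext fun g => by
        change Ff (Bc fun i => etaFn (GrpCat.of (G i)) (g i)) = fun i => etaFn (GrpCat.of (G i)) (g i)
        rw [hBeta, hFf])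
    exact fun y => congrFun h y
  exact ⟨{ toFun := Ff, invFun := Bc, left_inv := h1, right_inv := h2, map_mul' := map_mul Ff,
           continuous_toFun := Ff.continuous, continuous_invFun := Bc.continuous }, hFf⟩

/-- **Profinite completion commutes with finite products** (bare form).
[cite: RibesZalesskii2010, §3.2] -/
theorem nonempty_continuousMulEquiv_completion_pi :
    Nonempty (completion (GrpCat.of (∀ i, G i)) ≃ₜ* (∀ i, completion (GrpCat.of (G i)))) := by
  obtain ⟨e, -⟩ := exists_continuousMulEquiv_completion_pi G
  exact ⟨e⟩

end ProfiniteCompletionPi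

/-! ### Transport of a profinite completion along a group isomorphism -/

/-- Functoriality of the profinite completion along a group isomorphism, as an isomorphism of
topological groups compatible with `η`. [cite: RibesZalesskii2010, §3.2] -/
theorem exists_continuousMulEquiv_completion_of_mulEquiv {X Y : Type u} [Group X] [Group Y]
    (e : X ≃* Y) :
    ∃ f : completion (GrpCat.of X) ≃ₜ* completion (GrpCat.of Y),
      ∀ x : X, f (etaFn (GrpCat.of X) x) = etaFn (GrpCat.of Y) (e x) := by
  let i : GrpCat.of X ≅ GrpCat.of Y := e.toGrpIso
  let j := profiniteCompletion.mapIso i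
  let f : completion (GrpCat.of X) →ₜ* completion (GrpCat.of Y) := j.hom.hom
  let g : completion (GrpCat.of Y) →ₜ* completion (GrpCat.of X) := j.inv.hom
  have hgf : ∀ x, g (f x) = x := fun x => by
    have h := congrArg ProfiniteGrp.Hom.hom j.hom_inv_id
    rw [ProfiniteGrp.hom_comp, ProfiniteGrp.hom_id] at h
    exact DFunLike.congr_fun h x
  have hfg : ∀ y, f (g y) = y := fun y => by
    have h := congrArg ProfiniteGrp.Hom.hom j.inv_hom_id
    rw [ProfiniteGrp.hom_comp, ProfiniteGrp.hom_id] at h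
    exact DFunLike.congr_fun h y
  refine ⟨{ toFun := f, invFun := g, left_inv := hgf, right_inv := hfg, map_mul' := map_mul f,
            continuous_toFun := f.continuous, continuous_invFun := g.continuous }, fun x => ?_⟩
  change (lift (i.hom ≫ eta (GrpCat.of Y))).hom (etaFn (GrpCat.of X) x) = etaFn (GrpCat.of Y) (e x)
  rw [ProfiniteCompletionPi.lift_etaFn]
  rfl

/-! ### `Ẑ^m` versus `Fin m → Ẑ` and versus `Ẑ_Σ^m = ∏_{l ∈ Σ} ℤ_l^m` -/

/-- **`Ẑ^m ≃ₜ* (Fin m → Ẑ)`**: the profinite completion of `ℤ^m` is the `m`-fold product of the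
profinite completion `Ẑ` of `ℤ`, the `j`-th coordinate vector `η(e_j)` going to `(η(δ_{jk}))_k`.
[cite: RibesZalesskii2010, §3.2] -/
theorem exists_hatZPow_continuousMulEquiv_pi (m : ℕ) :
    ∃ e : FundamentalExtension.HatZPow m ≃ₜ* (Fin m → completion (GrpCat.of (Multiplicative ℤ))),
      ∀ v : Fin m → ℤ, e (etaFn (GrpCat.of (Multiplicative (Fin m → ℤ))) (Multiplicative.ofAdd v)) =
        fun j => etaFn (GrpCat.of (Multiplicative ℤ)) (Multiplicative.ofAdd (v j)) := by
  obtain ⟨f, hf⟩ := exists_continuousMulEquiv_completion_of_mulEquiv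
    (MulEquiv.piMultiplicative fun _ : Fin m => ℤ)
  obtain ⟨g, hg⟩ :=
    ProfiniteCompletionPi.exists_continuousMulEquiv_completion_pi fun _ : Fin m => Multiplicative ℤ
  refine ⟨f.trans g, fun v => ?_⟩
  change g (f (etaFn (GrpCat.of (Multiplicative (Fin m → ℤ))) (Multiplicative.ofAdd v))) = _
  rw [hf, hg]
  rfl

/-- **`Ẑ^m ≃ₜ* (Fin m → Ẑ)`** (bare form). [cite: RibesZalesskii2010, §3.2] -/
theorem nonempty_hatZPow_continuousMulEquiv_pi (m : ℕ) :
    Nonempty (FundamentalExtension.HatZPow m ≃ₜ* (Fin m → completion (GrpCat.of (Multiplicative ℤ)))) := by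
  obtain ⟨e, -⟩ := exists_hatZPow_continuousMulEquiv_pi m
  exact ⟨e⟩

/-- **`Ẑ^m ≃ₜ* (Fin m → ∏_p ℤ_p)`**. [cite: RibesZalesskii2010, Thm 2.7.1] -/
theorem nonempty_hatZPow_continuousMulEquiv_pi_padicProd (m : ℕ) :
    Nonempty (FundamentalExtension.HatZPow m ≃ₜ*
      (Fin m → Multiplicative (∀ p : Nat.Primes, @PadicInt (p : ℕ) ⟨p.2⟩))) := by
  obtain ⟨e, -⟩ := exists_hatZPow_continuousMulEquiv_pi m
  obtain ⟨f, -⟩ := ZHatCompletion.exists_continuousMulEquiv_padicProd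
  let g : (Fin m → completion (GrpCat.of (Multiplicative ℤ))) ≃ₜ*
      (Fin m → Multiplicative (∀ p : Nat.Primes, @PadicInt (p : ℕ) ⟨p.2⟩)) :=
    { toFun := fun x j => f (x j)
      invFun := fun y j => f.symm (y j)
      left_inv := fun x => funext fun j => f.symm_apply_apply (x j)
      right_inv := fun y => funext fun j => f.apply_symm_apply (y j)
      map_mul' := fun x y => funext fun j => map_mul f (x j) (y j)
      continuous_toFun := continuous_pi fun j => f.continuous.comp (continuous_apply j)
      continuous_invFun := continuous_pi fun j => f.symm.continuous.comp (continuous_apply j) }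
  exact ⟨e.trans g⟩

/-- **`Ẑ^m ≃ₜ* Ẑ_Σ^m = ∏_{l ∈ Σ} ℤ_l^m` for every `Σ` containing all primes** (so that
`Ẑ_Σ = ∏_l ℤ_l = Ẑ`): Mathlib's profinite completion of `ℤ^m` versus abc-iut-w6-d074's model
`HatZSigmaPow Σ m`. [cite: RibesZalesskii2010, Thm 2.7.1] -/
theorem nonempty_hatZPow_continuousMulEquiv_hatZSigmaPow {S : Set ℕ} (hS : ∀ l : ℕ, l.Prime → l ∈ S)
    (m : ℕ) : Nonempty (FundamentalExtension.HatZPow m ≃ₜ* HatZSigmaPow S m) := by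
  obtain ⟨e⟩ := nonempty_hatZPow_continuousMulEquiv_pi_padicProd m
  let r : (Fin m → Multiplicative (∀ p : Nat.Primes, @PadicInt (p : ℕ) ⟨p.2⟩)) ≃ₜ*
      HatZSigmaPow S m :=
    { toFun := fun x => Multiplicative.ofAdd fun j (l : {l : ℕ // l.Prime ∧ l ∈ S}) =>
        Multiplicative.toAdd (x j) ⟨l.1, l.2.1⟩
      invFun := fun y j => Multiplicative.ofAdd fun p : Nat.Primes =>
        Multiplicative.toAdd y j ⟨p.1, p.2, hS p.1 p.2⟩
      left_inv := fun x => rfl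
      right_inv := fun y => rfl
      map_mul' := fun x y => rfl
      continuous_toFun := continuous_ofAdd.comp (continuous_pi fun j => continuous_pi fun l =>
        (continuous_apply _).comp (continuous_toAdd.comp (continuous_apply j)))
      continuous_invFun := continuous_pi fun j => continuous_ofAdd.comp (continuous_pi fun p =>
        (continuous_apply _).comp ((continuous_apply j).comp continuous_toAdd)) }
  exact ⟨e.trans r⟩

/-! ### (∗) is (∗)_Σ at `Σ ⊇ Primes` -/

namespace FundamentalExtension

variable (E : FundamentalExtension.{u})

/-- **[AbsAnab] Lemma 1.1.4 (ii) (∗) ↔ [AbsTopI] Thm 2.6 (ii) (∗)_Σ at `Σ ⊇ Primes`.**  For a prime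
set `Σ` containing every prime, abc-iut-L4-t4's typed (∗) (`StarCondition`, target Mathlib's `Ẑ^m`)
and abc-iut-w6-d074's (∗)_Σ (`SigmaStarCondition Σ`, target the model `∏_{l ∈ Σ} ℤ_l^m`) are
EQUIVALENT: a continuous surjection `Δ″ ↠ T` with kernel `coinvRadical Π″` transports along
`Ẑ^m ≃ₜ* Ẑ_Σ^m`.  Hence the any-`Σ` closer `thm26ii_of_sigmaStarCondition` specialises to the printed
input (∗) at `Σ = Primes`. [cite: MochizukiAbsAnab2004, Lemma 1.1.4 (ii) p.7]
[cite: MochizukiAbsTopI2012, Thm 2.6 (ii) proof p.23] -/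
theorem starCondition_iff_sigmaStarCondition {S : Set ℕ} (hS : ∀ l : ℕ, l.Prime → l ∈ S) :
    E.StarCondition ↔ E.SigmaStarCondition S := by
  constructor
  · intro h P hP
    obtain ⟨m, q, hq, hker⟩ := h P hP
    obtain ⟨e⟩ := nonempty_hatZPow_continuousMulEquiv_hatZSigmaPow hS m
    refine ⟨m,
      { toFun := fun x => e (q x)
        map_one' := by rw [map_one, map_one]
        map_mul' := fun x y => by rw [map_mul, map_mul]
        continuous_toFun := e.continuous.comp q.continuous }, e.surjective.comp hq, fun x => ?_⟩
    change e (q x) = 1 ↔ _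
    rw [map_eq_one_iff e e.injective]
    exact hker x
  · intro h P hP
    obtain ⟨m, q, hq, hker⟩ := h P hP
    obtain ⟨e⟩ := nonempty_hatZPow_continuousMulEquiv_hatZSigmaPow hS m
    refine ⟨m,
      { toFun := fun x => e.symm (q x)
        map_one' := by rw [map_one, map_one]
        map_mul' := fun x y => by rw [map_mul, map_mul]
        continuous_toFun := e.symm.continuous.comp q.continuous }, e.symm.surjective.comp hq,
      fun x => ?_⟩
    change e.symm (q x) = 1 ↔ _
    rw [map_eq_one_iff e.symm e.symm.injective]
    exact hker x

/-- **(∗) ↔ (∗)_Primes.** [cite: MochizukiAbsTopI2012, Thm 2.6 (ii) proof p.23] -/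
theorem starCondition_iff_sigmaStarCondition_primes :
    E.StarCondition ↔ E.SigmaStarCondition {l : ℕ | l.Prime} :=
  E.starCondition_iff_sigmaStarCondition fun _ hl => hl

/-- **(∗) ↔ (∗)_Σ at `Σ = Set.univ`.** [cite: MochizukiAbsTopI2012, Thm 2.6 (ii) proof p.23] -/
theorem starCondition_iff_sigmaStarCondition_univ :
    E.StarCondition ↔ E.SigmaStarCondition Set.univ :=
  E.starCondition_iff_sigmaStarCondition fun _ _ => Set.mem_univ _

end FundamentalExtension

end Literature.AnabelianGeometry.AbsoluteAnabelian

end
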